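import Mathlib
import Summits.KontsevichZagierPeriods.KontsevichZagierPeriods.Theorems.SoloInformedDivisionThree
import Summits.KontsevichZagierPeriods.KontsevichZagierPeriods.Theorems.SoloInformedDivisionCirc
import HarnessLib
import HarnessLib.Audit

/-!
# Division by translation XI: the circular trisection packets in closed form (solo-informed, s43)

The trisection chain of part VIII (`soloInformedDivChainThree s`: `(0, s, √(s(2−s)), 1)` for the modulus
`m′ = (2s−1)/(s³(2−s))`, every real algebraic `½ < s < 1`; model `s = sn(K′/3 | m′)`) fed into THEOREM
XXIX(ii) KERNEL (part IX; the negative band, via part X, is part XII) gives, for the COMPLEMENTARY modulus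
`m = 1 − m′ = (1−s)³(1+s)/(s³(2−s))` and ALL representations, the one-parameter closed forms
(`σ := √(s(2−s))`; the circular Kummer scalar collapses to `c = m′ s σ`):

  **`⟦Π((1−s²)/(s(2−s)) | m)⟧ = ⟦[pt, (2−s)/3]⟧·⟦K(m)⟧ + ⟦[pt, sσ/(3(2s−1))]⟧·⟦π⟧`**   (`n = 1 − m′s₁²`;
  `soloInformed_trisection_circular`),
  **`⟦Π((1−s)²/s² | m)⟧ = ⟦[pt, (1+s)/3]⟧·⟦K(m)⟧ + ⟦[pt, sσ/(6(2s−1))]⟧·⟦π⟧`**         (`n = 1 − m′s₂²`, `s₂ = σ`, same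
  scalar `c`; `soloInformed_trisection_circular₂`),

e.g. `s = ⅔` (`m′ = 27/32`, `m = 5/32`, `σ = 2√2/3`): `9·Π(⅝ | 5/32) = 4K + 4√2·π`, `9·Π(¼ | 5/32) = 5K + 2√2·π`
(floats `10⁻¹⁴`); cf. the hyperbolic packet of part VIII `Π((2s−1)/(s(2−s))|m′) = (2−s)/(3(1−s))·K(m′)`.
References: C. Heuman, J. Math. Phys. 20 (1941); Abramowitz–Stegun 17.7; Kontsevich–Zagier, *Periods* (2001), §1.2.
-/

noncomputable section

open MeasureTheory Set Filter
open scoped Classical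

open Literature.NumberTheory.Transcendental Literature.NumberTheory.Transcendental.KZ
open Literature.ModelTheory.ExponentialFields

namespace Summit.KontsevichZagierPeriods.KontsevichZagierPeriods.Theorems

/-- Along the trisection chain the circular Kummer scalar is `c = m′ s σ`, `σ = √(s(2−s))`. [this work] -/
theorem soloInformed_trisection_circScalar {s : ℝ} (hs : s ∈ Ioo (1/2:ℝ) 1) :
    soloInformedM3 s * s * √(1 - s ^ 2) / √(1 - soloInformedM3 s * s ^ 2) =
      soloInformedM3 s * s * √(s * (2 - s)) := by
  obtain ⟨f1, -, -, -⟩ := soloInformed_s3_facts hs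
  obtain ⟨hσ, -, -, -, -, -⟩ := soloInformed_s3_sqrt hs
  have h1s : (0:ℝ) < 1 - s ^ 2 := by nlinarith [hs.1, hs.2]
  have hc0 : √(1 - s ^ 2) ≠ 0 := (Real.sqrt_pos.2 h1s).ne'
  have hpos : (0:ℝ) ≤ s * (2 - s) := by nlinarith [hs.1, hs.2]
  rw [f1, Real.sqrt_div' _ hpos]
  field_simp

/-- **COROLLARY (circular trisection packet, closed form; THEOREM XXIX(ii) at order 3).** For every real
algebraic `½ < s < 1`, `m′ = (2s−1)/(s³(2−s))`, `m = 1 − m′`, `n = 1 − m′s² = (1−s²)/(s(2−s))`, and all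
representations: `⟦Π(n | m)⟧ = ⟦[pt,(2−s)/3]⟧·⟦K(m)⟧ + ⟦[pt, s√(s(2−s))/(3(2s−1))]⟧·⟦π⟧`. [this work] -/
theorem soloInformed_trisection_circular (s : ℝ) (hs : s ∈ Ioo (1/2:ℝ) 1) (hsa : IsAlgebraic ℚ s)
    (PN K : IntegralRep 1) (hPNd : PN.domain = {x | x 0 ∈ Ioo (0:ℝ) 1})
    (hPNi : EqOn PN.integrand (fun x => (1 - (1 - s ^ 2) / (s * (2 - s)) * x 0 ^ 2)⁻¹ *
      ((√(1 - x 0 ^ 2))⁻¹ * (√(1 - (1 - (2 * s - 1) / (s ^ 3 * (2 - s))) * x 0 ^ 2))⁻¹))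
      PN.domain)
    (hKd : K.domain = {x | x 0 ∈ Ioo (0:ℝ) 1})
    (hKi : EqOn K.integrand (fun x => (√(1 - x 0 ^ 2))⁻¹ *
      (√(1 - (1 - (2 * s - 1) / (s ^ 3 * (2 - s))) * x 0 ^ 2))⁻¹) K.domain) :
    IsAlgebraic ℚ ((2 - s) / 3) ∧ IsAlgebraic ℚ (s * √(s * (2 - s)) / (3 * (2 * s - 1))) ∧
      ∀ (hA : IsAlgebraic ℚ ((2 - s) / 3))
        (hB : IsAlgebraic ℚ (s * √(s * (2 - s)) / (3 * (2 * s - 1)))),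
        toFormalPeriod (of PN) =
          toFormalPeriod (of (IntegralRep.unit.constMul _ hA)) * toFormalPeriod (of K) +
            toFormalPeriod (of (IntegralRep.unit.constMul _ hB)) * toFormalPeriod (of KZ.piRep) := by
  have hm := soloInformed_m3_mem hs
  have hma := soloInformed_m3_isAlgebraic hsa
  obtain ⟨f1, -, -, -⟩ := soloInformed_s3_facts hs
  obtain ⟨hσ, hsq, -, -, -, -⟩ := soloInformed_s3_sqrt hs
  have hc := soloInformed_trisection_circScalar hs
  have h0 : s ≠ 0 := (by linarith [hs.1] : (0:ℝ) < s).ne'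
  have h21 : 2 * s - 1 ≠ 0 := (by linarith [hs.1] : (0:ℝ) < 2 * s - 1).ne'
  have h2 : 2 - s ≠ 0 := (by linarith [hs.2] : (0:ℝ) < 2 - s).ne'
  have hm0 : soloInformedM3 s ≠ 0 := hm.1.ne'
  have h2a : IsAlgebraic ℚ (2:ℝ) := by simpa using isAlgebraic_nat (R := ℚ) (A := ℝ) 2
  have h3a : IsAlgebraic ℚ (3:ℝ) := by simpa using isAlgebraic_nat (R := ℚ) (A := ℝ) 3
  have hσa : IsAlgebraic ℚ (√(s * (2 - s))) := by
    have h := (soloInformed_divChain_mem (soloInformedDivChainThree s hs hsa) hm hma 2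
      (by norm_num)).2
    rwa [soloInformed_divChainThree_s, soloInformed_s3_two] at h
  have hA : IsAlgebraic ℚ ((2 - s) / 3) := by
    rw [div_eq_mul_inv]; exact (h2a.sub hsa).mul h3a.inv
  have hB : IsAlgebraic ℚ (s * √(s * (2 - s)) / (3 * (2 * s - 1))) := by
    rw [div_eq_mul_inv]
    exact (hsa.mul hσa).mul (h3a.mul ((h2a.mul hsa).sub isAlgebraic_one)).inv
  have hS1 : (soloInformedDivChainThree s hs hsa).s 1 = s := soloInformed_s3_one
  have hPNi' : EqOn PN.integrand (fun x => (1 - (1 - soloInformedM3 s *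
      (soloInformedDivChainThree s hs hsa).s 1 ^ 2) * x 0 ^ 2)⁻¹ *
      ((√(1 - x 0 ^ 2))⁻¹ * (√(1 - (1 - (2 * s - 1) / (s ^ 3 * (2 - s))) * x 0 ^ 2))⁻¹))
      PN.domain := by
    intro x hx
    rw [hPNi hx, hS1, f1]
  refine ⟨hA, hB, fun hA' hB' => ?_⟩
  obtain ⟨hA0, hB0, h⟩ := soloInformed_divChain_circular_pointClass
    (soloInformedDivChainThree s hs hsa) hm hma (p := 1) one_pos (by norm_num) PN K hPNd hPNi' hKd hKi
  rw [h hA0 hB0, soloInformed_pointRep_congr hA0 hA' ?_, soloInformed_pointRep_congr hB0 hB' ?_]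
  · -- the `π`-coefficient `B = ((q−p)/2)/(qc) = sσ/(3(2s−1))`
    rw [hS1, hc]
    push_cast
    set σ := √(s * (2 - s))
    have hσ0 : σ ≠ 0 := hσ.ne'
    have hM : soloInformedM3 s = (2 * s - 1) / (s ^ 2 * σ ^ 2) := by
      rw [hsq]; unfold soloInformedM3; congr 1; ring
    rw [hM]
    field_simp
    ring
  · -- the `K`-coefficient `A = 1 − ζ₃/(3c) = (2−s)/3`
    rw [hS1, soloInformed_divChainThree_zeta hs hsa, SoloInformedDivChain.zeta_one, hc]
    push_cast
    have hσ0 : √(s * (2 - s)) ≠ 0 := hσ.ne'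
    field_simp
    ring

/-- **COROLLARY (circular trisection packet), numerically:** `Π((1−s²)/(s(2−s)) | m) = (2−s)/3·K +
s√(s(2−s))/(3(2s−1))·π`, `m = 1 − (2s−1)/(s³(2−s))` (e.g. `9Π(⅝|5/32) = 4K + 4√2π`). [this work] -/
theorem soloInformed_trisection_circular_value (s : ℝ) (hs : s ∈ Ioo (1/2:ℝ) 1)
    (hsa : IsAlgebraic ℚ s)
    (PN K : IntegralRep 1) (hPNd : PN.domain = {x | x 0 ∈ Ioo (0:ℝ) 1})
    (hPNi : EqOn PN.integrand (fun x => (1 - (1 - s ^ 2) / (s * (2 - s)) * x 0 ^ 2)⁻¹ *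
      ((√(1 - x 0 ^ 2))⁻¹ * (√(1 - (1 - (2 * s - 1) / (s ^ 3 * (2 - s))) * x 0 ^ 2))⁻¹))
      PN.domain)
    (hKd : K.domain = {x | x 0 ∈ Ioo (0:ℝ) 1})
    (hKi : EqOn K.integrand (fun x => (√(1 - x 0 ^ 2))⁻¹ *
      (√(1 - (1 - (2 * s - 1) / (s ^ 3 * (2 - s))) * x 0 ^ 2))⁻¹) K.domain) :
    PN.value = (2 - s) / 3 * K.value + s * √(s * (2 - s)) / (3 * (2 * s - 1)) * Real.pi := by
  obtain ⟨hA, hB, h⟩ := soloInformed_trisection_circular s hs hsa PN K hPNd hPNi hKd hKi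
  have e := congrArg evalP (h hA hB)
  simpa only [map_mul, map_add, evalP_toFormalPeriod_of, IntegralRep.value_constMul,
    IntegralRep.value_unit, mul_one, KZ.piRep_value] using e

/-- At the second division point `s₂ = σ = √(s(2−s))` the circular Kummer scalar is the same `c = m′ s σ`. [this work] -/
theorem soloInformed_trisection_circScalar₂ {s : ℝ} (hs : s ∈ Ioo (1/2:ℝ) 1) :
    soloInformedM3 s * √(s * (2 - s)) * √(1 - (√(s * (2 - s))) ^ 2) /
        √(1 - soloInformedM3 s * (√(s * (2 - s))) ^ 2) =
      soloInformedM3 s * s * √(s * (2 - s)) := by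
  obtain ⟨-, -, -, -, f5, f6⟩ := soloInformed_s3_sqrt hs
  have h0 : s ≠ 0 := (by linarith [hs.1] : (0:ℝ) < s).ne'
  have h1 : 1 - s ≠ 0 := (by linarith [hs.2] : (0:ℝ) < 1 - s).ne'
  rw [f5, f6]; field_simp

/-- **COROLLARY (circular trisection packet at the second division point).** For every real algebraic `½ < s < 1`,
`m = 1 − (2s−1)/(s³(2−s))`, `n = 1 − m′σ² = (1−s)²/s²`, and all representations:
`⟦Π(n | m)⟧ = ⟦[pt,(1+s)/3]⟧·⟦K(m)⟧ + ⟦[pt, s√(s(2−s))/(6(2s−1))]⟧·⟦π⟧`. [this work] -/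
theorem soloInformed_trisection_circular₂ (s : ℝ) (hs : s ∈ Ioo (1/2:ℝ) 1) (hsa : IsAlgebraic ℚ s)
    (PN K : IntegralRep 1) (hPNd : PN.domain = {x | x 0 ∈ Ioo (0:ℝ) 1})
    (hPNi : EqOn PN.integrand (fun x => (1 - (1 - s) ^ 2 / s ^ 2 * x 0 ^ 2)⁻¹ *
      ((√(1 - x 0 ^ 2))⁻¹ * (√(1 - (1 - (2 * s - 1) / (s ^ 3 * (2 - s))) * x 0 ^ 2))⁻¹))
      PN.domain)
    (hKd : K.domain = {x | x 0 ∈ Ioo (0:ℝ) 1})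
    (hKi : EqOn K.integrand (fun x => (√(1 - x 0 ^ 2))⁻¹ *
      (√(1 - (1 - (2 * s - 1) / (s ^ 3 * (2 - s))) * x 0 ^ 2))⁻¹) K.domain) :
    IsAlgebraic ℚ ((1 + s) / 3) ∧ IsAlgebraic ℚ (s * √(s * (2 - s)) / (6 * (2 * s - 1))) ∧
      ∀ (hA : IsAlgebraic ℚ ((1 + s) / 3))
        (hB : IsAlgebraic ℚ (s * √(s * (2 - s)) / (6 * (2 * s - 1)))),
        toFormalPeriod (of PN) =
          toFormalPeriod (of (IntegralRep.unit.constMul _ hA)) * toFormalPeriod (of K) +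
            toFormalPeriod (of (IntegralRep.unit.constMul _ hB)) * toFormalPeriod (of KZ.piRep) := by
  have hm := soloInformed_m3_mem hs
  have hma := soloInformed_m3_isAlgebraic hsa
  obtain ⟨-, -, f3, -⟩ := soloInformed_s3_facts hs
  obtain ⟨hσ, hsq, -, -, -, -⟩ := soloInformed_s3_sqrt hs
  have hc := soloInformed_trisection_circScalar₂ hs
  have h0 : s ≠ 0 := (by linarith [hs.1] : (0:ℝ) < s).ne'
  have h21 : 2 * s - 1 ≠ 0 := (by linarith [hs.1] : (0:ℝ) < 2 * s - 1).ne'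
  have hm0 : soloInformedM3 s ≠ 0 := hm.1.ne'
  have h2a : IsAlgebraic ℚ (2:ℝ) := by simpa using isAlgebraic_nat (R := ℚ) (A := ℝ) 2
  have h3a : IsAlgebraic ℚ (3:ℝ) := by simpa using isAlgebraic_nat (R := ℚ) (A := ℝ) 3
  have h6a : IsAlgebraic ℚ (6:ℝ) := by simpa using isAlgebraic_nat (R := ℚ) (A := ℝ) 6
  have hσa : IsAlgebraic ℚ (√(s * (2 - s))) := by
    have h := (soloInformed_divChain_mem (soloInformedDivChainThree s hs hsa) hm hma 2
      (by norm_num)).2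
    rwa [soloInformed_divChainThree_s, soloInformed_s3_two] at h
  have hA : IsAlgebraic ℚ ((1 + s) / 3) := by
    rw [div_eq_mul_inv]; exact (isAlgebraic_one.add hsa).mul h3a.inv
  have hB : IsAlgebraic ℚ (s * √(s * (2 - s)) / (6 * (2 * s - 1))) := by
    rw [div_eq_mul_inv]
    exact (hsa.mul hσa).mul (h6a.mul ((h2a.mul hsa).sub isAlgebraic_one)).inv
  have hS2 : (soloInformedDivChainThree s hs hsa).s 2 = √(s * (2 - s)) := soloInformed_s3_two
  have hPNi' : EqOn PN.integrand (fun x => (1 - (1 - soloInformedM3 s *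
      (soloInformedDivChainThree s hs hsa).s 2 ^ 2) * x 0 ^ 2)⁻¹ *
      ((√(1 - x 0 ^ 2))⁻¹ * (√(1 - (1 - (2 * s - 1) / (s ^ 3 * (2 - s))) * x 0 ^ 2))⁻¹))
      PN.domain := by
    intro x hx
    rw [hPNi hx, hS2, hsq, f3]
  refine ⟨hA, hB, fun hA' hB' => ?_⟩
  obtain ⟨hA0, hB0, h⟩ := soloInformed_divChain_circular_pointClass
    (soloInformedDivChainThree s hs hsa) hm hma (p := 2) two_pos (by norm_num) PN K hPNd hPNi' hKd hKi
  rw [h hA0 hB0, soloInformed_pointRep_congr hA0 hA' ?_, soloInformed_pointRep_congr hB0 hB' ?_]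
  · -- `B = ((3−2)/2)/(3c) = sσ/(6(2s−1))`
    rw [hS2, hc]
    push_cast
    set σ := √(s * (2 - s))
    have hσ0 : σ ≠ 0 := hσ.ne'
    have hM : soloInformedM3 s = (2 * s - 1) / (s ^ 2 * σ ^ 2) := by
      rw [hsq]; unfold soloInformedM3; congr 1; ring
    rw [hM]
    field_simp
    ring
  · -- `A = 1 − (2ζ₃ − 3ζ₂)/(3c) = (1+s)/3`
    rw [hS2, soloInformed_divChainThree_zeta hs hsa, soloInformed_divChainThree_zeta₂ hs hsa, hc]
    push_cast
    have hσ0 : √(s * (2 - s)) ≠ 0 := hσ.ne'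
    field_simp
    ring

/-- **COROLLARY (circular packet, second point), numerically:** `Π((1−s)²/s² | m) = (1+s)/3·K +
s√(s(2−s))/(6(2s−1))·π`, `m = 1 − (2s−1)/(s³(2−s))` (e.g. `9Π(¼|5/32) = 5K + 2√2π`). [this work] -/
theorem soloInformed_trisection_circular₂_value (s : ℝ) (hs : s ∈ Ioo (1/2:ℝ) 1)
    (hsa : IsAlgebraic ℚ s)
    (PN K : IntegralRep 1) (hPNd : PN.domain = {x | x 0 ∈ Ioo (0:ℝ) 1})
    (hPNi : EqOn PN.integrand (fun x => (1 - (1 - s) ^ 2 / s ^ 2 * x 0 ^ 2)⁻¹ *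
      ((√(1 - x 0 ^ 2))⁻¹ * (√(1 - (1 - (2 * s - 1) / (s ^ 3 * (2 - s))) * x 0 ^ 2))⁻¹))
      PN.domain)
    (hKd : K.domain = {x | x 0 ∈ Ioo (0:ℝ) 1})
    (hKi : EqOn K.integrand (fun x => (√(1 - x 0 ^ 2))⁻¹ *
      (√(1 - (1 - (2 * s - 1) / (s ^ 3 * (2 - s))) * x 0 ^ 2))⁻¹) K.domain) :
    PN.value = (1 + s) / 3 * K.value + s * √(s * (2 - s)) / (6 * (2 * s - 1)) * Real.pi := by
  obtain ⟨hA, hB, h⟩ := soloInformed_trisection_circular₂ s hs hsa PN K hPNd hPNi hKd hKi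
  have e := congrArg evalP (h hA hB)
  simpa only [map_mul, map_add, evalP_toFormalPeriod_of, IntegralRep.value_constMul,
    IntegralRep.value_unit, mul_one, KZ.piRep_value] using e

end Summit.KontsevichZagierPeriods.KontsevichZagierPeriods.Theorems

end
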